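import Summits.QuantumFields.YangMills.Theses.FradkinShenkerFlow
import Summits.QuantumFields.YangMills.Theses.OneCertifiedCube
import Summits.QuantumFields.YangMills.Theorems.FradkinShenkerFlowFiniteSusceptibilityWeakCouplingSiblingFunnel
import HarnessLib

/-!
# `FiniteSusceptibilityWeakCoupling` — funnel entry from a Dobrushin–Shlosman finite-size condition at large `β`

Crux `stmt-QuantumFields-9442` (`FradkinShenkerFlow.FiniteSusceptibilityWeakCoupling`, line
`sup-axis-reflection-transfer`). A funnel entry of a different kind from the lattice-gap legs wired in
`…SiblingFunnel` (8778 / 8901 / 8761 / 8715): the total-variation finite-size condition of the Wilson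
specification `ymSpecification r.ρ β` (window `n`, threshold `ε` with `ε·M(n) < 1`,
`M(n) = (4n+3)⁴ − (4n+1)⁴`) at SOME cell size `b(β) ≥ 1`, at every `β ≥ β₂(G, r)`, implies the crux,
GIVEN the criterion `OneCertifiedCube.FiniteSizeCriterion` (item `stmt-QuantumFields-8895`, CLOSED — proved in
`Theorems/OneCertifiedCubeFiniteSizeCriterion.lean`; taken here as a named hypothesis so that this file
elaborates against the route file alone, and discharged by `FiniteSizeCriterion_proof` in the companion file
`…CAFunnel.lean`):

* the criterion turns the finite-size condition at cell size `b` into exponential time clustering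
  `|⟨A; τ_t B⟩_{β,S}| ≤ C(A,B) e^{-κ t / b}` on every torus of side `2S+1 ≥ (8n+7) b`, `t ≤ S`, with
  `κ = κ(n, ε) > 0` and `C` independent of `β, b, S`;
* `finiteSusceptibilityWeakCoupling_of_timeClusteringEventually` (landed, `…SiblingFunnel`) turns eventual
  exponential time clustering at every `β ≥ β₂` into the crux (the RP funnel).

The hypothesis `hFS` below is, per `(G, r)`, the conclusion of item `stmt-QuantumFields-16178`
(`CertificationLength.CompleteAnalyticityAtLargeScales`) at frame bound `B = 1`, stated for an arbitrary
`[BorelSpace G]` structure (the item fixes `borel G`).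

References: R. L. Dobrushin, S. B. Shlosman, *Completely analytical Gibbs fields* (Birkhäuser 1985), §2;
F. Martinelli, *Lectures on Glauber dynamics for discrete spin models*, LNM 1717 (1999), §2.3.
-/

set_option autoImplicit false

noncomputable section

open MeasureTheory
open Literature.MathematicalPhysics.QuantumFieldTheory hiding Site ZdEdge
open Literature.MathematicalPhysics.QuantumLattice

namespace Summit.QuantumFields.YangMills.Theorems.FiniteSusceptibilityWeakCoupling

/-- **Finite-size condition at large `β` ⇒ crux, given the criterion.** If the TV finite-size criterion
with universal threshold holds (`OneCertifiedCube.FiniteSizeCriterion`, item 8895, closed) and for every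
compact simple `G` and faithful unitary `r` there are admissible `(n, ε)` and `β₂` such that at every
`β ≥ β₂` the Wilson specification satisfies the Dobrushin–Shlosman TV finite-size condition at some cell size
`b ≥ 1`, then `FiniteSusceptibilityWeakCoupling`: time clustering at rate `κ(n,ε)/b` on all tori of side
`≥ (8n+7) b`, then the landed RP funnel. -/
theorem finiteSusceptibilityWeakCoupling_of_finiteSizeConditionAtLargeBeta
    (hcrit : Summit.QuantumFields.YangMills.Theses.OneCertifiedCube.FiniteSizeCriterion)
    (hFS : ∀ (G : Type) [Group G] [TopologicalSpace G] [IsTopologicalGroup G] [CompactSpace G]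
      [MeasurableSpace G] [BorelSpace G], IsCompactSimpleLieGroup G → ∀ (r : LatticeRep G),
      ∃ (n : ℕ) (ε : ℝ), 1 ≤ n ∧ 0 ≤ ε ∧ ε * ((((4 * n + 3) ^ 4 - (4 * n + 1) ^ 4 : ℕ)) : ℝ) < 1 ∧
        ∃ β₂ : ℝ, ∀ β : ℝ, β₂ ≤ β → ∃ b : ℕ, 1 ≤ b ∧
          (∀ w : Fin 4 → ℤ → ℤ, (∀ i j, w i j + ((b : ℕ) : ℤ) ≤ w i (j + 1) ∧ w i (j + 1) ≤ w i j + 2 * ((b : ℕ) : ℤ)) → ∀ Y : Finset (Fin 4 → ℤ), Y ⊆ (Fintype.piFinset fun _ : Fin 4 => Finset.Icc (-(2 * ((n : ℕ) : ℤ))) (2 * ((n : ℕ) : ℤ))) → (0 : Fin 4 → ℤ) ∈ Y → ∀ η η' : Literature.MathematicalPhysics.QuantumLattice.LGConfig 4 G, (∀ e ∈ (Fintype.piFinset fun _ : Fin 4 => Finset.Icc (-(2 * ((n : ℕ) : ℤ))) (2 * ((n : ℕ) : ℤ))).biUnion (fun y : Fin 4 → ℤ => (Fintype.piFinset fun i :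 Fin 4 => Finset.Ico (w i (y i)) (w i (y i + 1))) ×ˢ (Finset.univ : Finset (Fin 4))), η e = η' e) → ∀ f : Literature.MathematicalPhysics.QuantumLattice.LGConfig 4 G → ℝ, Literature.MathematicalPhysics.QuantumLattice.IsCylinder f ((fun y : Fin 4 → ℤ => (Fintype.piFinset fun i : Fin 4 => Finset.Ico (w i (y i)) (w i (y i + 1))) ×ˢ (Finset.univ : Finset (Fin 4))) 0) → Measurable f → (∀ U, 0 ≤ f U ∧ f U ≤ 1) → |(∫ U, f U ∂(Literature.MathematicalPhysics.QuantumLattice.ymSpecification r.ρ β (Y.biUnion (fun y : Fin 4 → ℤ => (Fintype.piFinset fun i : Fin 4 => Finset.Ico (w i (y i)) (w i (y i + 1))) ×ˢ (Finset.univ : Finset (Fin 4)))) η)) - ∫ U, f U ∂(Literature.MathematicalPhysics.QuantumLattice.ymSpecification r.ρ β (Y.biUnion (fun y : Fin 4 → ℤ => (Fintype.piFinset fun i : Fin 4 => Finset.Ico (w i (y i)) (w i (y i + 1))) ×ˢ (Finset.univ : Finset (Fin 4)))) η')| ≤ ε)) :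
    Summit.QuantumFields.YangMills.Theses.FradkinShenkerFlow.FiniteSusceptibilityWeakCoupling := by
  refine finiteSusceptibilityWeakCoupling_of_timeClusteringEventually fun G _ _ _ _ _ _ hG r => ?_
  obtain ⟨n, ε, hn, hε, hεM, β₂, hβ₂⟩ := hFS G hG r
  obtain ⟨κ, hκ, hC⟩ := hcrit n ε hn hε hεM
  refine ⟨β₂, fun β hβ => ?_⟩
  obtain ⟨b, hb1, hTV⟩ := hβ₂ β hβ
  have hb0 : (0 : ℝ) < b := by exact_mod_cast hb1
  refine ⟨κ / b, div_pos hκ hb0, fun A B => ?_⟩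
  obtain ⟨C, hC⟩ := hC G r.N r.ρ r.continuous r.injective A B
  refine ⟨C, (8 * n + 7) * b, fun S hS t ht => ?_⟩
  have hS' : (8 * n + 7) * b ≤ 2 * S + 1 := by omega
  have h1 := hC β b hb1 hTV S hS' t ht
  have h2 : κ * t / b = κ / b * t := by ring
  rwa [h2] at h1

/-- **Registered form** (stub `stub_cruxOfFiniteSizeConditionAtLargeBeta` of item stmt-QuantumFields-9442; signature `let`-free and
fully qualified): the criterion `OneCertifiedCube.FiniteSizeCriterion` (item 8895, closed) and the Dobrushin–Shlosman TV finite-size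
condition at some cell size at every `β ≥ β₂(G, r)` imply the crux `FiniteSusceptibilityWeakCoupling`. -/
theorem stub_cruxOfFiniteSizeConditionAtLargeBeta : Summit.QuantumFields.YangMills.Theses.OneCertifiedCube.FiniteSizeCriterion → (∀ (G : Type) [Group G] [TopologicalSpace G] [IsTopologicalGroup G] [CompactSpace G] [MeasurableSpace G] [BorelSpace G], Literature.MathematicalPhysics.QuantumFieldTheory.IsCompactSimpleLieGroup G → ∀ (r : Literature.MathematicalPhysics.QuantumFieldTheory.LatticeRep G), ∃ (n : ℕ) (ε : ℝ), 1 ≤ n ∧ 0 ≤ ε ∧ ε * ((((4 * n + 3) ^ 4 - (4 * n + 1) ^ 4 : ℕ)) : ℝ) < 1 ∧ ∃ β₂ : ℝ, ∀ β : ℝ, β₂ ≤ β → ∃ b : ℕ, 1 ≤ b ∧ (∀ w : Fin 4 → ℤ → ℤ, (∀ i j, w i j + ((b : ℕ) : ℤ) ≤ w i (j + 1) ∧ w i (j + 1) ≤ w i j + 2 * ((b : ℕ) : ℤ)) → ∀ Y : Finset (Fin 4 → ℤ), Y ⊆ (Fintype.piFinset fun _ : Fin 4 => Finset.Icc (-(2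 * ((n : ℕ) : ℤ))) (2 * ((n : ℕ) : ℤ))) → (0 : Fin 4 → ℤ) ∈ Y → ∀ η η' : Literature.MathematicalPhysics.QuantumLattice.LGConfig 4 G, (∀ e ∈ (Fintype.piFinset fun _ : Fin 4 => Finset.Icc (-(2 * ((n : ℕ) : ℤ))) (2 * ((n : ℕ) : ℤ))).biUnion (fun y : Fin 4 → ℤ => (Fintype.piFinset fun i : Fin 4 => Finset.Ico (w i (y i)) (w i (y i + 1))) ×ˢ (Finset.univ : Finset (Fin 4))), η e = η' e) → ∀ f : Literature.MathematicalPhysics.QuantumLattice.LGConfig 4 G → ℝ, Literature.MathematicalPhysics.QuantumLattice.IsCylinder f ((fun y : Fin 4 → ℤ => (Fintype.piFinset fun i : Fin 4 => Finset.Ico (w i (y i)) (w i (y i + 1))) ×ˢ (Finset.univ : Finset (Fin 4))) 0) → Measurable f → (∀ U, 0 ≤ f U ∧ f U ≤ 1) → |(∫ U, f U ∂(Literature.MathematicalPhysics.QuantumLattice.ymSpecification r.ρ β (Y.biUnion (fun y : Fin 4 → ℤ => (Fintype.piFinset fun i : Fin 4 => Finset.Ico (w i (y i)) (w i (y i + 1)))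 ×ˢ (Finset.univ : Finset (Fin 4)))) η)) - ∫ U, f U ∂(Literature.MathematicalPhysics.QuantumLattice.ymSpecification r.ρ β (Y.biUnion (fun y : Fin 4 → ℤ => (Fintype.piFinset fun i : Fin 4 => Finset.Ico (w i (y i)) (w i (y i + 1))) ×ˢ (Finset.univ : Finset (Fin 4)))) η')| ≤ ε)) → Summit.QuantumFields.YangMills.Theses.FradkinShenkerFlow.FiniteSusceptibilityWeakCoupling :=
  finiteSusceptibilityWeakCoupling_of_finiteSizeConditionAtLargeBeta

end Summit.QuantumFields.YangMills.Theorems.FiniteSusceptibilityWeakCoupling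

end
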